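import Summits.QuantumFields.YangMills.Theorems.LuscherReductionTwistedTraceScalingBODefect
import Summits.QuantumFields.YangMills.Theorems.FlatTubeReductionRecordWindowSixth
import HarnessLib

/-!
# THE (B-OD)-POTENTIAL DOOR IN `L²(w)` FOR THE RATE TWIN: the field `hODpot` of `RateTube.AnalyticRatePotInput` from a WEIGHTED `L²` QUASIMODE DEFECT with a SECOND-MOMENT
# POTENTIAL, `∫ E²w ≤ Λ²·(b²‖boFunAd φ Ω‖²_w + P(φ))`
# (route `FlatTubeReduction`, crux K1 `NearFlatRatioLaw` stmt-QuantumFields-24720; seat `ym-line-ftr-p1` g16; rate twin «ratepack-v5»; R2b1 RECORD rung — no summit statement is proved here)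

WHY (memo `Cruxes/NearFlatRatioLaw/Lines/ratepack-v5-nearpair-g16.md` §3; lane A COARSE-DESIGN §27).  Lane A's door `…BODefect.hOD_of_defect` turns an `L²(w)` bound on the defect
`E` of `K̃(φ⊗Ω)` against ANY dual BO function `ψ⊗Ω` into the field `hOD` of `RecordAnalyticInput` (Cauchy–Schwarz; the coefficient `ψ` is free because `v` is fibrewise
`w`-orthogonal to `Ω`).  The rate twin's field `hODpot` (`RateTube.AnalyticRatePotInput`) has (i) the ADAPTED BO functions `boFunAd φ Ω` with a `u`-dependent profile
`Ω u x = n(u)·Ω₀(x)` (the normaliser of the (B-N) brick) and the adapted orthogonality `fibreInnerAd`, and (ii) a second-moment POTENTIAL under the square root: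
`|X(boFunAd φ Ω, v)| ≤ Λ·√(b²‖boFunAd φ Ω‖²_w + P(φ))·‖v‖_w`, `P(φ) = κ_b·γ·∫_{d<δ₁} d²φ²` — the first-order-in-the-slow-amplitude part of the defect, which the assembly absorbs as a
potential (g12 `…DressedSlowRatePot`).  This file is the corresponding door: the SAME Cauchy–Schwarz with the defect budget `∫ E²w ≤ Λ²(b²T + P)`.
* `integral_mul_boFunAd_mul_eq_zero` — `∫ v·(boFunAd ψ Ω)·w = 0` for `v` fibrewise `w`-orthogonal to `Ω` (`integral_boFunAd_mul_eq`);
* ★★★ `tubeCross_boFunAd_le_of_defect` — `|X(boFunAd φ Ω, v)|, |X(v, boFunAd φ Ω)| ≤ √(∫E²w)·√(tubeNormSq w v)`;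
* ★★ `tubeCross_boFunAd_le_pot_of_defect` — with `∫ E²w ≤ Λ²(b²T + P)`, `P ≥ 0`: `≤ Λ·√(b²T + P)·√(tubeNormSq w v)` (both orders);
* `defect_of_weight_lower_bound_ad` — manufacturing `E = 𝟙_S(F/w − boFunAd ψ Ω)` where `w ≥ w₀ > 0`;
* ★★★ `hODpot_of_defect` — the `∀ᶠ β` wrapper producing LITERALLY the field `hODpot` of `RateTube.AnalyticRatePotInput L D M` (weight `softWeight (recordChi L (1/6) (42D+1) M β)`,
  window `orbitDist < D·recordDelta1 L (1/6) β`, level `σ β·λ₀(1,L³β)`, potential `κ_b·γ β·∫ 𝟙_{d<δ₁}d²φ²`).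
HONEST FRAMING: a reduction (Cauchy–Schwarz) only; the `L²` defect estimate with the `d²`-potential is the OPEN content of hODpot-rate ((C1) at rate `β^{-1/3}`, (C2) colour term in
`L²`); femto rung R2b1 (RECORD label); not infinite volume, not a gap, not Clay.  No defs, no named facts, no `sorry`.
-/

set_option autoImplicit false

noncomputable section

open MeasureTheory Filter Topology Real
open scoped BigOperators
open Literature.MathematicalPhysics.QuantumFieldTheory
open Literature.MathematicalPhysics.QuantumLattice

namespace Summit.QuantumFields.YangMills.Theorems.FemtoTransferGap.RateTube

open Summit.QuantumFields.YangMills.Theorems.FemtoTransferGap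
open Summit.QuantumFields.YangMills.Theorems.FemtoTransferGap.TwoLattice
open Summit.QuantumFields.YangMills.Theorems.FemtoTransferGap.TwoLattice.ConstTube
open Summit.QuantumFields.YangMills.Theorems.FemtoTransferGap.TwoLattice.Avg
open Summit.QuantumFields.YangMills.Theorems.FemtoTransferGap.TwoLattice.Stiff (LinkSpace)

variable {L : ℕ} [NeZero L]

/-! ## §1 The orthogonality that kills the adapted coefficient -/

/-- `∫ v·(boFunAd ψ Ω)·w = ∫ ψ(u)·fibreInnerAd_w(Ω,v)(u) du = 0` when `v` is fibrewise `w`-orthogonal to the adapted profile `Ω`. [folklore] -/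
theorem integral_mul_boFunAd_mul_eq_zero {Ω : GaugeConfig 3 1 SU2 → LinkSpace L → ℝ} (hΩm : Measurable (Function.uncurry Ω)) {CΩ : ℝ} (hCΩ : ∀ u x, |Ω u x| ≤ CΩ)
    {w : GaugeConfig 3 L SU2 → ℝ} (hwm : Measurable w) {Cw : ℝ} (hCw : ∀ U, |w U| ≤ Cw)
    {v : GaugeConfig 3 L SU2 → ℝ} (hvm : Measurable v) {Cv : ℝ} (hCv : ∀ U, |v U| ≤ Cv) (horth : ∀ u, fibreInnerAd L w Ω v u = 0)
    {ψ : GaugeConfig 3 1 SU2 → ℝ} (hψm : Measurable ψ) {Cψ : ℝ} (hCψ : ∀ u, |ψ u| ≤ Cψ) :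
    ∫ U, v U * boFunAd L ψ Ω U * w U ∂configMeasure SU2 L = 0 := by
  have e : (fun U => v U * boFunAd L ψ Ω U * w U) = fun U => boFunAd L ψ Ω U * v U * w U := funext fun U => by ring
  rw [e, integral_boFunAd_mul_eq hψm hCψ hΩm hCΩ hvm hCv hwm hCw]
  have e2 : (fun u => ψ u * fibreInnerAd L w Ω v u) = fun _ => (0 : ℝ) := funext fun u => by rw [horth u, mul_zero]
  rw [e2, integral_zero]

/-! ## §2 ★★★ The door in tube currency, adapted profile -/

/-- ★★★ **THE (B-OD) DOOR IN `L²(w)`, ADAPTED PROFILE.**  Let `v` be fibrewise `w`-orthogonal to `Ω` (`fibreInnerAd`) and suppose the transfer of the adapted BO function decomposes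
on `supp v` as `K̃(boFunAd φ Ω)(U) = (boFunAd ψ Ω U + E U)·w U` for SOME bounded measurable `ψ`, `E`.  Then `|X(boFunAd φ Ω, v)| ≤ √(∫ E²w)·√(tubeNormSq w v)`, and the same for
`X(v, boFunAd φ Ω)`. [cite: Luscher1983, §3] [cite: SjostrandZworski2007, §2] -/
theorem tubeCross_boFunAd_le_of_defect (β : ℝ) {Ω : GaugeConfig 3 1 SU2 → LinkSpace L → ℝ} (hΩm : Measurable (Function.uncurry Ω)) {CΩ : ℝ} (hCΩ : ∀ u x, |Ω u x| ≤ CΩ)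
    {w : GaugeConfig 3 L SU2 → ℝ} (hwm : Measurable w) {Cw : ℝ} (hCw : ∀ U, |w U| ≤ Cw) (hw0 : ∀ U, 0 ≤ w U)
    {φ : GaugeConfig 3 1 SU2 → ℝ} (hφm : Measurable φ) {Cφ : ℝ} (hCφ : ∀ u, |φ u| ≤ Cφ)
    {v : GaugeConfig 3 L SU2 → ℝ} (hvm : Measurable v) {Cv : ℝ} (hCv : ∀ U, |v U| ≤ Cv) (horth : ∀ u, fibreInnerAd L w Ω v u = 0)
    {ψ : GaugeConfig 3 1 SU2 → ℝ} (hψm : Measurable ψ) {Cψ : ℝ} (hCψ : ∀ u, |ψ u| ≤ Cψ)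
    {E : GaugeConfig 3 L SU2 → ℝ} (hEm : Measurable E) {CE : ℝ} (hCE : ∀ U, |E U| ≤ CE)
    (hF : ∀ U, v U ≠ 0 → ∫ V, avgKernel β U V * boFunAd L φ Ω V ∂configMeasure SU2 L = (boFunAd L ψ Ω U + E U) * w U) :
    |tubeCross β (boFunAd L φ Ω) v| ≤ Real.sqrt (∫ U, E U ^ 2 * w U ∂configMeasure SU2 L) * Real.sqrt (tubeNormSq w v) ∧
      |tubeCross β v (boFunAd L φ Ω)| ≤ Real.sqrt (∫ U, E U ^ 2 * w U ∂configMeasure SU2 L) * Real.sqrt (tubeNormSq w v) := by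
  have h2 : |tubeCross β v (boFunAd L φ Ω)| ≤ Real.sqrt (∫ U, E U ^ 2 * w U ∂configMeasure SU2 L) * Real.sqrt (tubeNormSq w v) := by
    rw [tubeCross_eq_integral_mul]
    unfold tubeNormSq
    exact abs_integral_mul_le_of_defect (configMeasure SU2 L) hvm (measurable_boFunAd L hψm hΩm) hEm hwm hCv (abs_boFunAd_le L hCψ hCΩ) hCE hCw hw0
      (integral_mul_boFunAd_mul_eq_zero hΩm hCΩ hwm hCw hvm hCv horth hψm hCψ) hF
  refine ⟨?_, h2⟩
  rw [tubeCross_comm β (measurable_boFunAd L hφm hΩm) (abs_boFunAd_le L hCφ hCΩ) hvm hCv]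
  exact h2

/-! ## §3 ★★ The hODpot currency -/

/-- ★★ **(B-OD) WITH POTENTIAL FROM THE DEFECT.**  With the data of `tubeCross_boFunAd_le_of_defect`, if `∫ E²w ≤ Λ²·(b²·tubeNormSq w (boFunAd φ Ω) + P)` (`Λ ≥ 0`, `P ≥ 0`) then
`|X(boFunAd φ Ω, v)|, |X(v, boFunAd φ Ω)| ≤ Λ·√(b²·tubeNormSq w (boFunAd φ Ω) + P)·√(tubeNormSq w v)` — the two inequalities of the field `hODpot` (`Λ = σλ₀(1,L³β)`,
`P = κ_bγ∫_{d<δ₁}d²φ²`). [cite: Luscher1983, §3] [cite: SjostrandZworski2007, §2] -/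
theorem tubeCross_boFunAd_le_pot_of_defect (β : ℝ) {Ω : GaugeConfig 3 1 SU2 → LinkSpace L → ℝ} (hΩm : Measurable (Function.uncurry Ω)) {CΩ : ℝ} (hCΩ : ∀ u x, |Ω u x| ≤ CΩ)
    {w : GaugeConfig 3 L SU2 → ℝ} (hwm : Measurable w) {Cw : ℝ} (hCw : ∀ U, |w U| ≤ Cw) (hw0 : ∀ U, 0 ≤ w U)
    {φ : GaugeConfig 3 1 SU2 → ℝ} (hφm : Measurable φ) {Cφ : ℝ} (hCφ : ∀ u, |φ u| ≤ Cφ)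
    {v : GaugeConfig 3 L SU2 → ℝ} (hvm : Measurable v) {Cv : ℝ} (hCv : ∀ U, |v U| ≤ Cv) (horth : ∀ u, fibreInnerAd L w Ω v u = 0)
    {ψ : GaugeConfig 3 1 SU2 → ℝ} (hψm : Measurable ψ) {Cψ : ℝ} (hCψ : ∀ u, |ψ u| ≤ Cψ)
    {E : GaugeConfig 3 L SU2 → ℝ} (hEm : Measurable E) {CE : ℝ} (hCE : ∀ U, |E U| ≤ CE)
    (hF : ∀ U, v U ≠ 0 → ∫ V, avgKernel β U V * boFunAd L φ Ω V ∂configMeasure SU2 L = (boFunAd L ψ Ω U + E U) * w U)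
    {b Λ P : ℝ} (hΛ : 0 ≤ Λ) (hP : 0 ≤ P) (hD : ∫ U, E U ^ 2 * w U ∂configMeasure SU2 L ≤ Λ ^ 2 * (b ^ 2 * tubeNormSq w (boFunAd L φ Ω) + P)) :
    |tubeCross β (boFunAd L φ Ω) v| ≤ Λ * Real.sqrt (b ^ 2 * tubeNormSq w (boFunAd L φ Ω) + P) * Real.sqrt (tubeNormSq w v) ∧
      |tubeCross β v (boFunAd L φ Ω)| ≤ Λ * Real.sqrt (b ^ 2 * tubeNormSq w (boFunAd L φ Ω) + P) * Real.sqrt (tubeNormSq w v) := by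
  obtain ⟨h1, h2⟩ := tubeCross_boFunAd_le_of_defect β hΩm hCΩ hwm hCw hw0 hφm hCφ hvm hCv horth hψm hCψ hEm hCE hF
  have hT0 : 0 ≤ tubeNormSq w (boFunAd L φ Ω) := tubeNormSq_nonneg' hw0 _
  have hQ0 : 0 ≤ b ^ 2 * tubeNormSq w (boFunAd L φ Ω) + P := by positivity
  have hsq : Real.sqrt (∫ U, E U ^ 2 * w U ∂configMeasure SU2 L) ≤ Λ * Real.sqrt (b ^ 2 * tubeNormSq w (boFunAd L φ Ω) + P) := by
    calc Real.sqrt (∫ U, E U ^ 2 * w U ∂configMeasure SU2 L) ≤ Real.sqrt (Λ ^ 2 * (b ^ 2 * tubeNormSq w (boFunAd L φ Ω) + P)) := Real.sqrt_le_sqrt hD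
      _ = Λ * Real.sqrt (b ^ 2 * tubeNormSq w (boFunAd L φ Ω) + P) := by rw [Real.sqrt_mul (sq_nonneg _), Real.sqrt_sq hΛ]
  have hv0 : 0 ≤ Real.sqrt (tubeNormSq w v) := Real.sqrt_nonneg _
  exact ⟨h1.trans (mul_le_mul_of_nonneg_right hsq hv0), h2.trans (mul_le_mul_of_nonneg_right hsq hv0)⟩

/-! ## §4 Manufacturing the defect where the weight is bounded below -/

/-- **The defect by division, adapted profile.**  On a measurable set `S ⊇ supp v` where `w ≥ w₀ > 0`, `E := 𝟙_S·(F/w − boFunAd ψ Ω)` is bounded measurable and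
`F = (boFunAd ψ Ω + E)·w` on `supp v`. [folklore] -/
theorem defect_of_weight_lower_bound_ad {Ω : GaugeConfig 3 1 SU2 → LinkSpace L → ℝ} (hΩm : Measurable (Function.uncurry Ω)) {CΩ : ℝ} (hCΩ : ∀ u x, |Ω u x| ≤ CΩ)
    {w : GaugeConfig 3 L SU2 → ℝ} (hwm : Measurable w) {S : Set (GaugeConfig 3 L SU2)} (hS : MeasurableSet S) {w₀ : ℝ} (hw₀ : 0 < w₀) (hwS : ∀ U ∈ S, w₀ ≤ w U)
    {v : GaugeConfig 3 L SU2 → ℝ} (hvS : ∀ U, v U ≠ 0 → U ∈ S) {ψ : GaugeConfig 3 1 SU2 → ℝ} (hψm : Measurable ψ) {Cψ : ℝ} (hCψ : ∀ u, |ψ u| ≤ Cψ)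
    {F : GaugeConfig 3 L SU2 → ℝ} (hFm : Measurable F) {CF : ℝ} (hCF : ∀ U, |F U| ≤ CF) :
    Measurable (S.indicator fun U => F U / w U - boFunAd L ψ Ω U) ∧
      (∀ U, |S.indicator (fun U => F U / w U - boFunAd L ψ Ω U) U| ≤ CF / w₀ + Cψ * CΩ) ∧
      ∀ U, v U ≠ 0 → F U = (boFunAd L ψ Ω U + S.indicator (fun U => F U / w U - boFunAd L ψ Ω U) U) * w U := by
  have hCF0 : 0 ≤ CF := (abs_nonneg _).trans (hCF 1)
  refine ⟨((hFm.div hwm).sub (measurable_boFunAd L hψm hΩm)).indicator hS, fun U => ?_, fun U hU => ?_⟩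
  · by_cases hUS : U ∈ S
    · rw [Set.indicator_of_mem hUS]
      have hwU : w₀ ≤ w U := hwS U hUS
      have hwpos : 0 < w U := hw₀.trans_le hwU
      have h1 : |F U / w U| ≤ CF / w₀ := by
        rw [abs_div, abs_of_pos hwpos]
        exact div_le_div₀ hCF0 (hCF U) hw₀ hwU
      have h2 := abs_boFunAd_le L hCψ hCΩ U (φ := ψ) (Ω := Ω)
      exact (abs_sub _ _).trans (add_le_add h1 h2)
    · rw [Set.indicator_of_notMem hUS, abs_zero]
      have hCψ0 : 0 ≤ Cψ := (abs_nonneg _).trans (hCψ 1)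
      have hCΩ0 : 0 ≤ CΩ := (abs_nonneg _).trans (hCΩ 1 0)
      positivity
  · have hUS : U ∈ S := hvS U hU
    rw [Set.indicator_of_mem hUS]
    have hwpos : 0 < w U := hw₀.trans_le (hwS U hUS)
    field_simp
    ring

/-! ## §5 ★★★ The `∀ᶠ β` wrapper: the field `hODpot` of `RateTube.AnalyticRatePotInput` from the `L²(w)` defect with potential -/

/-- ★★★ **hODpot FROM THE DEFECT (family form).**  For an adapted profile family `Ω β : GaugeConfig 3 1 SU2 → LinkSpace L → ℝ` (jointly measurable, `|Ω| ≤ 1`), the record weight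
`w_β = softWeight (recordChi L (1/6) (42D+1) M β)`, rates `σ β > 0`, `γ β`, `b β ≥ 0`, a constant `κ_b ≥ 0`: if eventually every bounded measurable gauge-invariant `φ` supported in the
window `{orbitDist < D·recordDelta1 L (1/6) β}` has a dual slow amplitude `ψ` and a defect `E` with `K̃(boFunAd φ (Ω β)) = (boFunAd ψ (Ω β) + E)·w_β` on `{recordChi ≠ 0}` and
`∫ E²w_β ≤ (σ β·λ₀(1,L³β))²·(b β²·‖boFunAd φ (Ω β)‖²_{w_β} + κ_b·γ β·∫ 𝟙_{d<δ₁}d²φ²)`, then the field `hODpot` holds VERBATIM. [cite: Luscher1983, §3] [cite: SjostrandZworski2007, §2] -/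
theorem hODpot_of_defect {D M : ℝ} {Ω : ℝ → GaugeConfig 3 1 SU2 → LinkSpace L → ℝ} (hΩm : ∀ β, Measurable (Function.uncurry (Ω β))) (hΩ1 : ∀ β u x, |Ω β u x| ≤ 1)
    {σ γ b : ℝ → ℝ} {κb : ℝ} (hσ : ∀ β, 0 < σ β) (hκb : 0 ≤ κb) (hγ : ∀ β, 0 < γ β)
    (hdef : ∀ᶠ β in atTop, ∀ φ : GaugeConfig 3 1 SU2 → ℝ, Measurable φ → (∃ C : ℝ, ∀ u, |φ u| ≤ C) →
      (∀ (g : Site 3 1 → SU2) (u : GaugeConfig 3 1 SU2), φ (gaugeTransform g u) = φ u) → (∀ u, φ u ≠ 0 → orbitDist u < D * recordDelta1 L (1 / 6) β) →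
      ∃ (ψ : GaugeConfig 3 1 SU2 → ℝ) (E : GaugeConfig 3 L SU2 → ℝ), Measurable ψ ∧ (∃ C : ℝ, ∀ u, |ψ u| ≤ C) ∧ Measurable E ∧ (∃ C : ℝ, ∀ U, |E U| ≤ C) ∧
        (∀ U, recordChi L (1 / 6) (42 * D + 1) M β U ≠ 0 →
          ∫ V, avgKernel β U V * boFunAd L φ (Ω β) V ∂configMeasure SU2 L = (boFunAd L ψ (Ω β) U + E U) * softWeight (recordChi L (1 / 6) (42 * D + 1) M β) U) ∧
        ∫ U, E U ^ 2 * softWeight (recordChi L (1 / 6) (42 * D + 1) M β) U ∂configMeasure SU2 L ≤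
          (σ β * levelValue su2Rep 1 ((L : ℝ) ^ 3 * β) 0) ^ 2 *
            (b β ^ 2 * tubeNormSq (softWeight (recordChi L (1 / 6) (42 * D + 1) M β)) (boFunAd L φ (Ω β)) +
              κb * γ β * ∫ u, (if orbitDist u < D * recordDelta1 L (1 / 6) β then orbitDist u ^ 2 else 0) * φ u ^ 2 ∂configMeasure SU2 1)) :
    ∀ᶠ β in atTop, ∀ (φ : GaugeConfig 3 1 SU2 → ℝ) (v : GaugeConfig 3 L SU2 → ℝ), Measurable φ → (∃ C : ℝ, ∀ u, |φ u| ≤ C) →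
      (∀ (g : Site 3 1 → SU2) (u : GaugeConfig 3 1 SU2), φ (gaugeTransform g u) = φ u) → (∀ u, φ u ≠ 0 → orbitDist u < D * recordDelta1 L (1 / 6) β) →
      Measurable v → (∃ C : ℝ, ∀ U, |v U| ≤ C) → (∀ U, v U ≠ 0 → recordChi L (1 / 6) (42 * D + 1) M β U ≠ 0) →
      (∀ u, fibreInnerAd L (softWeight (recordChi L (1 / 6) (42 * D + 1) M β)) (Ω β) v u = 0) →
      |tubeCross β (boFunAd L φ (Ω β)) v| ≤ (σ β * levelValue su2Rep 1 ((L : ℝ) ^ 3 * β) 0) *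
          Real.sqrt (b β ^ 2 * tubeNormSq (softWeight (recordChi L (1 / 6) (42 * D + 1) M β)) (boFunAd L φ (Ω β)) +
            κb * γ β * ∫ u, (if orbitDist u < D * recordDelta1 L (1 / 6) β then orbitDist u ^ 2 else 0) * φ u ^ 2 ∂configMeasure SU2 1) *
          Real.sqrt (tubeNormSq (softWeight (recordChi L (1 / 6) (42 * D + 1) M β)) v) ∧
      |tubeCross β v (boFunAd L φ (Ω β))| ≤ (σ β * levelValue su2Rep 1 ((L : ℝ) ^ 3 * β) 0) *
          Real.sqrt (b β ^ 2 * tubeNormSq (softWeight (recordChi L (1 / 6) (42 * D + 1) M β)) (boFunAd L φ (Ω β)) +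
            κb * γ β * ∫ u, (if orbitDist u < D * recordDelta1 L (1 / 6) β then orbitDist u ^ 2 else 0) * φ u ^ 2 ∂configMeasure SU2 1) *
          Real.sqrt (tubeNormSq (softWeight (recordChi L (1 / 6) (42 * D + 1) M β)) v) := by
  have hL3 : (0 : ℝ) ≤ (L : ℝ) ^ 3 := by positivity
  filter_upwards [hdef, eventually_ge_atTop (0 : ℝ)] with β hβ hβ0 φ v hφm hφb hφg hφs hvm hvb hvχ horth
  obtain ⟨Cφ, hCφ⟩ := hφb
  obtain ⟨Cv, hCv⟩ := hvb
  obtain ⟨ψ, E, hψm, ⟨Cψ, hCψ⟩, hEm, ⟨CE, hCE⟩, hF, hD⟩ := hβ φ hφm ⟨Cφ, hCφ⟩ hφg hφs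
  obtain ⟨hwm, hCw, hw0, -⟩ := softWeight_recordChi_props (L := L) (1 / 6) (42 * D + 1) M β
  have hΛ : 0 ≤ σ β * levelValue su2Rep 1 ((L : ℝ) ^ 3 * β) 0 := mul_nonneg (hσ β).le (levelValue_su2Rep_nonneg 1 (mul_nonneg hL3 hβ0) 0)
  have hP : 0 ≤ κb * γ β * ∫ u, (if orbitDist u < D * recordDelta1 L (1 / 6) β then orbitDist u ^ 2 else 0) * φ u ^ 2 ∂configMeasure SU2 1 := by
    have : 0 ≤ ∫ u, (if orbitDist u < D * recordDelta1 L (1 / 6) β then orbitDist u ^ 2 else 0) * φ u ^ 2 ∂configMeasure SU2 1 :=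
      integral_nonneg fun u => mul_nonneg (by split_ifs <;> positivity) (sq_nonneg _)
    exact mul_nonneg (mul_nonneg hκb (hγ β).le) this
  exact tubeCross_boFunAd_le_pot_of_defect β (hΩm β) (hΩ1 β) hwm hCw hw0 hφm hCφ hvm hCv horth hψm hCψ hEm hCE (fun U hU => hF U (hvχ U hU)) hΛ hP hD

end Summit.QuantumFields.YangMills.Theorems.FemtoTransferGap.RateTube

end
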